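import Mathlib
import Summits.ValiantsHypothesis.ValiantsHypothesis.Theorems.KPlusLogSqLawLiftingLocalDescartesChain
import Summits.ValiantsHypothesis.ValiantsHypothesis.Theorems.LacunarySymmetroidMatrixDescartesCensusDoorA34Letters

/-!
# Leibniz-term dominance of an ARBITRARY real pencil ⇒ archimedean monomial dominance: dominance windows of general pencils

HONEST FRAMING.  Helper file toward the lifting crux `WeakLifting` (stmt-ValiantsHypothesis-19561; aside `Lifting`
stmt-ValiantsHypothesis-19772, registered stub `stub_liftThin`) of route `KPlusLogSqLaw` (cell `pub-symmetroid`, seat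
val-sym-lift-p1 g9, 2026-08-27).  PENCIL-LEVEL statements about ONE real pencil `F = Σ_l X^{d_l} S_l` with ARBITRARY real `m × m`
matrices `S_l` (no symmetry, no integrality, no base): mechanism (M2) «dominance windows» of GAP-LIFT §3 (val-sym-lift-p4) as kernel
theorems.  Nothing here asserts `WeakLifting`, `TropicalB`, Conjecture B, `MatrixDescartes` (stmt-ValiantsHypothesis-18050) or anything
about VP ≠ VNP; at FORMAT level these windows merge for the maximisers (GAP-LIFT §3 (M2)), so nothing here beats Descartes on a format.

SETTING.  Leibniz terms `q = (σ, f)` (`σ` a permutation, `f : Fin m → Fin K` a row-to-letter map) with product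
`π(q) = Π_i S_{f i}(σ i, i)`, slope `D(q) = Σ_i d(f i)` and ARCHIMEDEAN MASS `|π(q)| x^{D(q)}` at `x > 0`; `det F = Σ_s c_s X^s` with
`c_s = Σ_{D(q) = s} sign(σ) π(q)` (the tree's `Census.coeff_det_pencil`).  «`p` is LEIBNIZ-DOMINANT at `x`» means
`Σ_{q ≠ p} |π(q)| x^{D(q)} < |π(p)| x^{D(p)}` — one term of the Leibniz expansion outweighs all others together (for the patchworked
pencil of a tropical design this is `tropical margin M` with `N ≤ b^M`, `…LiftingFiniteBaseDominance`).

RESULTS.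
* `coeff_det_pencil_eq_sum_filter`, `exists_term_of_mem_support`, `sum_coeff_mass_le_sum_terms`, `coeff_mul_pow_eq_term_add` —
  Leibniz bookkeeping (fibrewise regrouping of the coefficient masses by slope).
* `monomial_dominant_of_leibniz_dominant` — LEIBNIZ DOMINANCE ⇒ MONOMIAL DOMINANCE: if `p` is Leibniz-dominant at `x = a` then the
  monomial `x^{D(p)}` archimedean-dominates `det F` at `a` (`Σ_{s ≠ D(p)} |c_s| a^s < |c_{D(p)}| a^{D(p)}`), `det F (a)` and `c_{D(p)}` have
  the sign of `sign(σ) π(p)` (`term_mul_eval_pos_of_leibniz_dominant`, `term_mul_coeff_pos_of_leibniz_dominant`).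
* `card_roots_window_le_signVar_of_leibniz_dominant` — WINDOW LAW FOR GENERAL PENCILS: between two Leibniz-dominance points `a < a'`
  (terms `p`, `p'`) the distinct zeros of `det F` number at most `Var(c_s : D(p) ≤ s ≤ D(p'))`.
* `card_posRoots_le_sum_signVar_of_leibniz_chain`, `card_posRoots_eq_card_alternating_of_leibniz_chain` — along a chain of
  Leibniz-dominance points the DISTRIBUTION LAW and, when the chain's slopes span the slopes of the non-vanishing Leibniz terms with none
  strictly in between, the EXACT COUNT `#{k : sign π(P_k) ≠ sign π(P_{k+1})}` of distinct positive zeros of `det F`.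
No `def`.  [folklore] (Leibniz expansion + the local Descartes rule.)
-/

set_option linter.dupNamespace false
set_option autoImplicit false

namespace Summit.ValiantsHypothesis.ValiantsHypothesis.Theorems.KPlusLogSqLaw.LocalDescartes

open Polynomial Finset
open scoped BigOperators
open Literature.Algebra.Polynomial (signVar)
open Summit.ValiantsHypothesis.ValiantsHypothesis.Theorems.LacunarySymmetroidMatrixDescartes (Census.coeff_det_pencil)
open Summit.ValiantsHypothesis.ValiantsHypothesis.Theorems.KPlusLogSqLaw.ExactPatchwork (mul_eval_pos_of_dominant)

variable {m K : ℕ}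

/-! ## Leibniz bookkeeping -/

/-- the coefficient of `X^n` in `det (Σ_l X^{d_l} S_l)` as a sum over the Leibniz terms `(σ, f)` of slope `n`. [folklore] -/
theorem coeff_det_pencil_eq_sum_filter (d : Fin K → ℕ) (S : Fin K → Matrix (Fin m) (Fin m) ℝ) (n : ℕ) :
    (Matrix.det (∑ l, ((X : ℝ[X]) ^ d l) • (S l).map C)).coeff n
      = ∑ q ∈ (Finset.univ : Finset (Equiv.Perm (Fin m) × (Fin m → Fin K))).filter (fun q => (∑ i, d (q.2 i)) = n),
          ((Equiv.Perm.sign q.1 : ℤ) : ℝ) * ∏ i, S (q.2 i) (q.1 i) i := by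
  classical
  rw [Census.coeff_det_pencil, Finset.sum_filter, ← Finset.univ_product_univ, Finset.sum_product]
  refine Finset.sum_congr rfl fun σ _ => Finset.sum_congr rfl fun f _ => ?_
  by_cases h : (∑ i, d (f i)) = n
  · rw [if_pos h.symm, if_pos h]
  · rw [if_neg (fun h' => h h'.symm), if_neg h]

/-- every exponent of the support of `det F` is the slope of a Leibniz term with non-zero product. [folklore] -/
theorem exists_term_of_mem_support (d : Fin K → ℕ) (S : Fin K → Matrix (Fin m) (Fin m) ℝ) {s : ℕ}
    (hs : s ∈ (Matrix.det (∑ l, ((X : ℝ[X]) ^ d l) • (S l).map C)).support) :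
    ∃ q : Equiv.Perm (Fin m) × (Fin m → Fin K), (∏ i, S (q.2 i) (q.1 i) i) ≠ 0 ∧ (∑ i, d (q.2 i)) = s := by
  classical
  by_contra hcon
  push Not at hcon
  rw [Polynomial.mem_support_iff, coeff_det_pencil_eq_sum_filter] at hs
  refine hs (Finset.sum_eq_zero fun q hq => ?_)
  have hD : (∑ i, d (q.2 i)) = s := (Finset.mem_filter.mp hq).2
  by_cases hz : (∏ i, S (q.2 i) (q.1 i) i) = 0
  · rw [hz, mul_zero]
  · exact absurd hD (hcon q hz)

/-- `|sign σ| = 1` in `ℝ`. [folklore] -/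
theorem abs_cast_sign_eq_one (σ : Equiv.Perm (Fin m)) : |((Equiv.Perm.sign σ : ℤ) : ℝ)| = 1 := by
  rcases Int.units_eq_one_or (Equiv.Perm.sign σ) with h | h <;> rw [h] <;> simp

/-- **Fibrewise regrouping**: for `x ≥ 0` and any set `T` of exponents, `Σ_{s ∈ T} |c_s| x^s ≤ Σ_{D(q) ∈ T} |π(q)| x^{D(q)}`. [folklore] -/
theorem sum_coeff_mass_le_sum_terms (d : Fin K → ℕ) (S : Fin K → Matrix (Fin m) (Fin m) ℝ) (T : Finset ℕ) {x : ℝ}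
    (hx : 0 ≤ x) :
    ∑ s ∈ T, |(Matrix.det (∑ l, ((X : ℝ[X]) ^ d l) • (S l).map C)).coeff s| * x ^ s
      ≤ ∑ q ∈ (Finset.univ : Finset (Equiv.Perm (Fin m) × (Fin m → Fin K))).filter (fun q => (∑ i, d (q.2 i)) ∈ T),
          |∏ i, S (q.2 i) (q.1 i) i| * x ^ (∑ i, d (q.2 i)) := by
  classical
  set F : Equiv.Perm (Fin m) × (Fin m → Fin K) → ℝ := fun q => |∏ i, S (q.2 i) (q.1 i) i| * x ^ (∑ i, d (q.2 i)) with hF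
  have hfib : ∑ q ∈ (Finset.univ : Finset (Equiv.Perm (Fin m) × (Fin m → Fin K))).filter (fun q => (∑ i, d (q.2 i)) ∈ T), F q
      = ∑ s ∈ T, ∑ q ∈ (Finset.univ : Finset (Equiv.Perm (Fin m) × (Fin m → Fin K))).filter
          (fun q => (∑ i, d (q.2 i)) = s), F q := by
    rw [← Finset.sum_fiberwise_of_maps_to (s := (Finset.univ : Finset (Equiv.Perm (Fin m) × (Fin m → Fin K))).filter
      (fun q => (∑ i, d (q.2 i)) ∈ T)) (t := T) (g := fun q => ∑ i, d (q.2 i)) (fun q hq => (Finset.mem_filter.mp hq).2) F]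
    refine Finset.sum_congr rfl fun s hs => Finset.sum_congr ?_ fun _ _ => rfl
    ext q
    simp only [Finset.mem_filter, Finset.mem_univ, true_and]
    exact ⟨fun h => h.2, fun h => ⟨h ▸ hs, h⟩⟩
  rw [hfib]
  refine Finset.sum_le_sum fun s _ => ?_
  rw [coeff_det_pencil_eq_sum_filter]
  calc |∑ q ∈ Finset.univ.filter (fun q : Equiv.Perm (Fin m) × (Fin m → Fin K) => (∑ i, d (q.2 i)) = s),
          ((Equiv.Perm.sign q.1 : ℤ) : ℝ) * ∏ i, S (q.2 i) (q.1 i) i| * x ^ s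
      ≤ (∑ q ∈ Finset.univ.filter (fun q : Equiv.Perm (Fin m) × (Fin m → Fin K) => (∑ i, d (q.2 i)) = s),
          |∏ i, S (q.2 i) (q.1 i) i|) * x ^ s := by
        refine mul_le_mul_of_nonneg_right ((Finset.abs_sum_le_sum_abs _ _).trans (le_of_eq ?_)) (pow_nonneg hx s)
        refine Finset.sum_congr rfl fun q _ => ?_
        rw [abs_mul, abs_cast_sign_eq_one, one_mul]
    _ = ∑ q ∈ Finset.univ.filter (fun q : Equiv.Perm (Fin m) × (Fin m → Fin K) => (∑ i, d (q.2 i)) = s), F q := by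
        rw [Finset.sum_mul]
        refine Finset.sum_congr rfl fun q hq => ?_
        have hqs : (∑ i, d (q.2 i)) = s := (Finset.mem_filter.mp hq).2
        simp only [hF, hqs]

/-- the coefficient of the slope `D(p)`, scaled to `x`, is the term `p` plus its slope-class competitors. [folklore] -/
theorem coeff_mul_pow_eq_term_add (d : Fin K → ℕ) (S : Fin K → Matrix (Fin m) (Fin m) ℝ) (x : ℝ)
    (p : Equiv.Perm (Fin m) × (Fin m → Fin K)) :
    (Matrix.det (∑ l, ((X : ℝ[X]) ^ d l) • (S l).map C)).coeff (∑ i, d (p.2 i)) * x ^ (∑ i, d (p.2 i))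
      = ((Equiv.Perm.sign p.1 : ℤ) : ℝ) * (∏ i, S (p.2 i) (p.1 i) i) * x ^ (∑ i, d (p.2 i))
        + ∑ q ∈ (Finset.univ.erase p).filter (fun q => (∑ i, d (q.2 i)) = ∑ i, d (p.2 i)),
            ((Equiv.Perm.sign q.1 : ℤ) : ℝ) * (∏ i, S (q.2 i) (q.1 i) i) * x ^ (∑ i, d (q.2 i)) := by
  classical
  rw [coeff_det_pencil_eq_sum_filter, Finset.sum_mul]
  have hp : p ∈ Finset.univ.filter (fun q : Equiv.Perm (Fin m) × (Fin m → Fin K) => (∑ i, d (q.2 i)) = ∑ i, d (p.2 i)) :=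
    Finset.mem_filter.mpr ⟨Finset.mem_univ _, rfl⟩
  rw [← Finset.add_sum_erase _ _ hp, Finset.filter_erase]
  congr 1
  refine Finset.sum_congr rfl fun q hq => ?_
  have hD : (∑ i, d (q.2 i)) = ∑ i, d (p.2 i) := (Finset.mem_filter.mp (Finset.mem_of_mem_erase hq)).2
  rw [hD]

/-! ## Leibniz dominance ⇒ monomial dominance -/

/-- a Leibniz-dominant term has a non-zero product. [folklore] -/
theorem prod_ne_zero_of_leibniz_dominant (d : Fin K → ℕ) (S : Fin K → Matrix (Fin m) (Fin m) ℝ) {a : ℝ} (ha : 0 < a)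
    (p : Equiv.Perm (Fin m) × (Fin m → Fin K))
    (hdomL : ∑ q ∈ Finset.univ.erase p, |∏ i, S (q.2 i) (q.1 i) i| * a ^ (∑ i, d (q.2 i))
      < |∏ i, S (p.2 i) (p.1 i) i| * a ^ (∑ i, d (p.2 i))) :
    (∏ i, S (p.2 i) (p.1 i) i) ≠ 0 := by
  intro h
  rw [h, abs_zero, zero_mul] at hdomL
  exact absurd hdomL (not_lt.mpr (Finset.sum_nonneg fun q _ => mul_nonneg (abs_nonneg _) (pow_nonneg ha.le _)))

/-- **LEIBNIZ DOMINANCE ⇒ MONOMIAL DOMINANCE.**  If ONE Leibniz term `p = (σ, f)` of the pencil `F = Σ_l X^{d_l} S_l` (arbitrary real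
matrices) outweighs all other Leibniz terms together at `x = a > 0` — `Σ_{q ≠ p} |π(q)| a^{D(q)} < |π(p)| a^{D(p)}` — then the MONOMIAL
`x^{D(p)}` archimedean-dominates `det F` at `a`: `Σ_{s ≠ D(p)} |c_s| a^s < |c_{D(p)}| a^{D(p)}` (the hypothesis shape of the local Descartes
rule).  Mechanism (M2) «dominance windows» of GAP-LIFT §3 at pencil level. [folklore] -/
theorem monomial_dominant_of_leibniz_dominant (d : Fin K → ℕ) (S : Fin K → Matrix (Fin m) (Fin m) ℝ) {a : ℝ} (ha : 0 < a)
    (p : Equiv.Perm (Fin m) × (Fin m → Fin K))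
    (hdomL : ∑ q ∈ Finset.univ.erase p, |∏ i, S (q.2 i) (q.1 i) i| * a ^ (∑ i, d (q.2 i))
      < |∏ i, S (p.2 i) (p.1 i) i| * a ^ (∑ i, d (p.2 i))) :
    ∑ s ∈ (Matrix.det (∑ l, ((X : ℝ[X]) ^ d l) • (S l).map C)).support.erase (∑ i, d (p.2 i)),
        |(Matrix.det (∑ l, ((X : ℝ[X]) ^ d l) • (S l).map C)).coeff s| * a ^ s
      < |(Matrix.det (∑ l, ((X : ℝ[X]) ^ d l) • (S l).map C)).coeff (∑ i, d (p.2 i))| * a ^ (∑ i, d (p.2 i)) := by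
  classical
  set g := Matrix.det (∑ l, ((X : ℝ[X]) ^ d l) • (S l).map C) with hg
  set Dp := ∑ i, d (p.2 i) with hDp
  set F : Equiv.Perm (Fin m) × (Fin m → Fin K) → ℝ := fun q => |∏ i, S (q.2 i) (q.1 i) i| * a ^ (∑ i, d (q.2 i)) with hF
  -- (1) off-slope coefficient mass is carried by terms of other slopes
  have h1 : ∑ s ∈ g.support.erase Dp, |g.coeff s| * a ^ s
      ≤ ∑ q ∈ (Finset.univ.erase p).filter (fun q => (∑ i, d (q.2 i)) ≠ Dp), F q := by
    refine (sum_coeff_mass_le_sum_terms d S (g.support.erase Dp) ha.le).trans ?_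
    refine Finset.sum_le_sum_of_subset_of_nonneg (fun q hq => ?_) (fun q _ _ => ?_)
    · have hq' := (Finset.mem_filter.mp hq).2
      have hne : (∑ i, d (q.2 i)) ≠ Dp := (Finset.mem_erase.mp hq').1
      exact Finset.mem_filter.mpr ⟨Finset.mem_erase.mpr ⟨fun h => hne (by rw [h]), Finset.mem_univ _⟩, hne⟩
    · exact mul_nonneg (abs_nonneg _) (pow_nonneg ha.le _)
  -- (2) the on-slope coefficient is the dominant term up to its slope-class competitors
  have h2 : F p - ∑ q ∈ (Finset.univ.erase p).filter (fun q => (∑ i, d (q.2 i)) = Dp), F q ≤ |g.coeff Dp| * a ^ Dp := by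
    have hid := coeff_mul_pow_eq_term_add d S a p
    rw [← hg, ← hDp] at hid
    rw [← abs_of_nonneg (pow_nonneg ha.le Dp), ← abs_mul, hid]
    have hmain : |((Equiv.Perm.sign p.1 : ℤ) : ℝ) * (∏ i, S (p.2 i) (p.1 i) i) * a ^ Dp| = F p := by
      simp only [hF, hDp]
      rw [abs_mul, abs_mul, abs_cast_sign_eq_one, one_mul, abs_of_nonneg (pow_nonneg ha.le _)]
    have hR : |∑ q ∈ (Finset.univ.erase p).filter (fun q => (∑ i, d (q.2 i)) = Dp),
        ((Equiv.Perm.sign q.1 : ℤ) : ℝ) * (∏ i, S (q.2 i) (q.1 i) i) * a ^ (∑ i, d (q.2 i))|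
        ≤ ∑ q ∈ (Finset.univ.erase p).filter (fun q => (∑ i, d (q.2 i)) = Dp), F q := by
      refine (Finset.abs_sum_le_sum_abs _ _).trans (le_of_eq (Finset.sum_congr rfl fun q _ => ?_))
      simp only [hF]
      rw [abs_mul, abs_mul, abs_cast_sign_eq_one, one_mul, abs_of_nonneg (pow_nonneg ha.le _)]
    have htri := abs_sub_abs_le_abs_add (((Equiv.Perm.sign p.1 : ℤ) : ℝ) * (∏ i, S (p.2 i) (p.1 i) i) * a ^ Dp)
      (∑ q ∈ (Finset.univ.erase p).filter (fun q => (∑ i, d (q.2 i)) = Dp),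
        ((Equiv.Perm.sign q.1 : ℤ) : ℝ) * (∏ i, S (q.2 i) (q.1 i) i) * a ^ (∑ i, d (q.2 i)))
    rw [hmain] at htri
    linarith
  -- (3) all competitors together weigh less than the dominant term
  have h3 : ∑ q ∈ (Finset.univ.erase p).filter (fun q => (∑ i, d (q.2 i)) ≠ Dp), F q
      + ∑ q ∈ (Finset.univ.erase p).filter (fun q => (∑ i, d (q.2 i)) = Dp), F q < F p := by
    rw [add_comm, Finset.sum_filter_add_sum_filter_not]
    exact hdomL
  linarith

/-- **The merged coefficient at a Leibniz-dominance point has the sign of its term**: `sign(σ) π(p) · c_{D(p)} > 0`. [folklore] -/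
theorem term_mul_coeff_pos_of_leibniz_dominant (d : Fin K → ℕ) (S : Fin K → Matrix (Fin m) (Fin m) ℝ) {a : ℝ} (ha : 0 < a)
    (p : Equiv.Perm (Fin m) × (Fin m → Fin K))
    (hdomL : ∑ q ∈ Finset.univ.erase p, |∏ i, S (q.2 i) (q.1 i) i| * a ^ (∑ i, d (q.2 i))
      < |∏ i, S (p.2 i) (p.1 i) i| * a ^ (∑ i, d (p.2 i))) :
    0 < (((Equiv.Perm.sign p.1 : ℤ) : ℝ) * ∏ i, S (p.2 i) (p.1 i) i)
      * (Matrix.det (∑ l, ((X : ℝ[X]) ^ d l) • (S l).map C)).coeff (∑ i, d (p.2 i)) := by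
  classical
  set g := Matrix.det (∑ l, ((X : ℝ[X]) ^ d l) • (S l).map C) with hg
  set Dp := ∑ i, d (p.2 i) with hDp
  set sπ := ((Equiv.Perm.sign p.1 : ℤ) : ℝ) * ∏ i, S (p.2 i) (p.1 i) i with hsπ
  have hx : 0 < a ^ Dp := pow_pos ha _
  have hπ : (∏ i, S (p.2 i) (p.1 i) i) ≠ 0 := prod_ne_zero_of_leibniz_dominant d S ha p hdomL
  have habs : |sπ| = |∏ i, S (p.2 i) (p.1 i) i| := by rw [hsπ, abs_mul, abs_cast_sign_eq_one, one_mul]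
  have hsπ0 : sπ ≠ 0 := fun h => by rw [← abs_eq_zero, habs, abs_eq_zero] at h; exact hπ h
  suffices h : 0 < sπ * (g.coeff Dp * a ^ Dp) by
    rw [← mul_assoc] at h
    exact pos_of_mul_pos_left h hx.le
  rw [coeff_mul_pow_eq_term_add d S a p, ← hDp, ← hsπ, mul_add]
  set R := ∑ q ∈ (Finset.univ.erase p).filter (fun q => (∑ i, d (q.2 i)) = Dp),
      ((Equiv.Perm.sign q.1 : ℤ) : ℝ) * (∏ i, S (q.2 i) (q.1 i) i) * a ^ (∑ i, d (q.2 i)) with hR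
  have hmain : sπ * (sπ * a ^ Dp) = |sπ| ^ 2 * a ^ Dp := by rw [sq_abs]; ring
  have hrest : |sπ * R| ≤ |sπ| * ∑ q ∈ Finset.univ.erase p, |∏ i, S (q.2 i) (q.1 i) i| * a ^ (∑ i, d (q.2 i)) := by
    rw [abs_mul]
    refine mul_le_mul_of_nonneg_left ?_ (abs_nonneg _)
    refine (Finset.abs_sum_le_sum_abs _ _).trans ?_
    calc ∑ q ∈ (Finset.univ.erase p).filter (fun q => (∑ i, d (q.2 i)) = Dp),
          |((Equiv.Perm.sign q.1 : ℤ) : ℝ) * (∏ i, S (q.2 i) (q.1 i) i) * a ^ (∑ i, d (q.2 i))|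
        ≤ ∑ q ∈ Finset.univ.erase p, |((Equiv.Perm.sign q.1 : ℤ) : ℝ) * (∏ i, S (q.2 i) (q.1 i) i) * a ^ (∑ i, d (q.2 i))| :=
          Finset.sum_le_sum_of_subset_of_nonneg (Finset.filter_subset _ _) (fun q _ _ => abs_nonneg _)
      _ = ∑ q ∈ Finset.univ.erase p, |∏ i, S (q.2 i) (q.1 i) i| * a ^ (∑ i, d (q.2 i)) :=
          Finset.sum_congr rfl fun q _ => by
            rw [abs_mul, abs_mul, abs_cast_sign_eq_one, one_mul, abs_of_nonneg (pow_nonneg ha.le _)]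
  have hlt : |sπ| * ∑ q ∈ Finset.univ.erase p, |∏ i, S (q.2 i) (q.1 i) i| * a ^ (∑ i, d (q.2 i)) < |sπ| ^ 2 * a ^ Dp := by
    have := mul_lt_mul_of_pos_left hdomL (abs_pos.mpr hsπ0)
    rw [← habs] at this
    calc |sπ| * ∑ q ∈ Finset.univ.erase p, |∏ i, S (q.2 i) (q.1 i) i| * a ^ (∑ i, d (q.2 i))
        < |sπ| * (|sπ| * a ^ Dp) := this
      _ = |sπ| ^ 2 * a ^ Dp := by ring
  rw [hmain]
  have := neg_abs_le (sπ * R)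
  linarith

/-- **Sign of `det F` at a Leibniz-dominance point**: `sign(σ) π(p) · det F(a) > 0`. [folklore] -/
theorem term_mul_eval_pos_of_leibniz_dominant (d : Fin K → ℕ) (S : Fin K → Matrix (Fin m) (Fin m) ℝ) {a : ℝ} (ha : 0 < a)
    (p : Equiv.Perm (Fin m) × (Fin m → Fin K))
    (hdomL : ∑ q ∈ Finset.univ.erase p, |∏ i, S (q.2 i) (q.1 i) i| * a ^ (∑ i, d (q.2 i))
      < |∏ i, S (p.2 i) (p.1 i) i| * a ^ (∑ i, d (p.2 i))) :
    0 < (((Equiv.Perm.sign p.1 : ℤ) : ℝ) * ∏ i, S (p.2 i) (p.1 i) i)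
      * (Matrix.det (∑ l, ((X : ℝ[X]) ^ d l) • (S l).map C)).eval a := by
  have h1 := mul_eval_pos_of_dominant _ ha (monomial_dominant_of_leibniz_dominant d S ha p hdomL)
  have h2 := term_mul_coeff_pos_of_leibniz_dominant d S ha p hdomL
  set g := Matrix.det (∑ l, ((X : ℝ[X]) ^ d l) • (S l).map C)
  set c := g.coeff (∑ i, d (p.2 i))
  set sπ := ((Equiv.Perm.sign p.1 : ℤ) : ℝ) * ∏ i, S (p.2 i) (p.1 i) i
  have h3 : 0 < (sπ * c) * (c * g.eval a) := mul_pos h2 h1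
  have h4 : (sπ * c) * (c * g.eval a) = c ^ 2 * (sπ * g.eval a) := by ring
  rw [h4] at h3
  exact pos_of_mul_pos_right h3 (sq_nonneg c)

/-! ## Windows and chains of Leibniz-dominance points -/

/-- **WINDOW LAW FOR GENERAL PENCILS.**  If the Leibniz term `p` outweighs all others at `a > 0` and `p'` does at `a' > a`, then the
number of distinct zeros of `det F` in `(a, a')` is at most `Var(c_s : D(p) ≤ s ≤ D(p'))` — the local Descartes rule between two
dominance windows of an arbitrary real pencil (GAP-LIFT §3 (M2), pencil level). [folklore] -/
theorem card_roots_window_le_signVar_of_leibniz_dominant (d : Fin K → ℕ) (S : Fin K → Matrix (Fin m) (Fin m) ℝ) {a a' : ℝ}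
    (ha : 0 < a) (haa' : a < a') (p p' : Equiv.Perm (Fin m) × (Fin m → Fin K))
    (hdomL : ∑ q ∈ Finset.univ.erase p, |∏ i, S (q.2 i) (q.1 i) i| * a ^ (∑ i, d (q.2 i))
      < |∏ i, S (p.2 i) (p.1 i) i| * a ^ (∑ i, d (p.2 i)))
    (hdomL' : ∑ q ∈ Finset.univ.erase p', |∏ i, S (q.2 i) (q.1 i) i| * a' ^ (∑ i, d (q.2 i))
      < |∏ i, S (p'.2 i) (p'.1 i) i| * a' ^ (∑ i, d (p'.2 i))) :
    ((Matrix.det (∑ l, ((X : ℝ[X]) ^ d l) • (S l).map C)).roots.toFinset.filter (fun x => a < x ∧ x < a')).card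
      ≤ signVar ((List.range ((∑ i, d (p'.2 i)) + 1 - ∑ i, d (p.2 i))).map
          (fun k => (Matrix.det (∑ l, ((X : ℝ[X]) ^ d l) • (S l).map C)).coeff ((∑ i, d (p.2 i)) + k))) := by
  have h1 := monomial_dominant_of_leibniz_dominant d S ha p hdomL
  have h2 := monomial_dominant_of_leibniz_dominant d S (ha.trans haa') p' hdomL'
  exact card_roots_Ioo_le_signVar_coeffs _ ha haa' (le_of_dominant_of_lt _ ha haa' h1 h2) h1 h2

/-- **DISTRIBUTION LAW ALONG A CHAIN OF LEIBNIZ-DOMINANCE POINTS** (general pencils): if the terms `P_0, …, P_r` are Leibniz-dominant at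
`0 < a_0 < ⋯ < a_r`, the distinct positive zeros of `det F` number at most
`Var(c_0..c_{D P_0}) + Σ_k Var(c_{D P_k}..c_{D P_{k+1}}) + Var(c_{D P_r}..c_n)`. [folklore] -/
theorem card_posRoots_le_sum_signVar_of_leibniz_chain (d : Fin K → ℕ) (S : Fin K → Matrix (Fin m) (Fin m) ℝ) (r : ℕ)
    (a : Fin (r + 1) → ℝ) (ha : StrictMono a) (ha0 : 0 < a 0) (P : Fin (r + 1) → Equiv.Perm (Fin m) × (Fin m → Fin K))
    (hdomL : ∀ k, ∑ q ∈ Finset.univ.erase (P k), |∏ i, S (q.2 i) (q.1 i) i| * a k ^ (∑ i, d (q.2 i))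
      < |∏ i, S ((P k).2 i) ((P k).1 i) i| * a k ^ (∑ i, d ((P k).2 i))) :
    ((Matrix.det (∑ l, ((X : ℝ[X]) ^ d l) • (S l).map C)).roots.toFinset.filter (fun t => 0 < t)).card
      ≤ signVar ((List.range ((∑ i, d ((P 0).2 i)) + 1)).map (Matrix.det (∑ l, ((X : ℝ[X]) ^ d l) • (S l).map C)).coeff)
        + ∑ k : Fin r, signVar ((List.range ((∑ i, d ((P k.succ).2 i)) + 1 - ∑ i, d ((P k.castSucc).2 i))).map
            (fun j => (Matrix.det (∑ l, ((X : ℝ[X]) ^ d l) • (S l).map C)).coeff ((∑ i, d ((P k.castSucc).2 i)) + j)))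
        + signVar ((List.range ((Matrix.det (∑ l, ((X : ℝ[X]) ^ d l) • (S l).map C)).natDegree + 1
              - ∑ i, d ((P (Fin.last r)).2 i))).map
            (fun j => (Matrix.det (∑ l, ((X : ℝ[X]) ^ d l) • (S l).map C)).coeff ((∑ i, d ((P (Fin.last r)).2 i)) + j))) :=
  card_posRoots_le_sum_signVar _ r (fun k => ∑ i, d ((P k).2 i)) a ha ha0
    (fun k => monomial_dominant_of_leibniz_dominant d S (lt_of_lt_of_le ha0 (ha.monotone (Fin.zero_le _))) (P k) (hdomL k))

/-- **EXACT COUNT ALONG A CHAIN OF LEIBNIZ-DOMINANCE POINTS WITHOUT HIDDEN SLOPES** (general pencils): if moreover every Leibniz term with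
non-zero product has slope in `[D(P_0), D(P_r)]` and none strictly between consecutive `D(P_k)`, then the number of distinct positive zeros
of `det F` EQUALS `#{k : sign(σ_k)π(P_k) · sign(σ_{k+1})π(P_{k+1}) < 0}`. [folklore] -/
theorem card_posRoots_eq_card_alternating_of_leibniz_chain (d : Fin K → ℕ) (S : Fin K → Matrix (Fin m) (Fin m) ℝ) (r : ℕ)
    (a : Fin (r + 1) → ℝ) (ha : StrictMono a) (ha0 : 0 < a 0) (P : Fin (r + 1) → Equiv.Perm (Fin m) × (Fin m → Fin K))
    (hdomL : ∀ k, ∑ q ∈ Finset.univ.erase (P k), |∏ i, S (q.2 i) (q.1 i) i| * a k ^ (∑ i, d (q.2 i))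
      < |∏ i, S ((P k).2 i) ((P k).1 i) i| * a k ^ (∑ i, d ((P k).2 i)))
    (hrange : ∀ q : Equiv.Perm (Fin m) × (Fin m → Fin K), (∏ i, S (q.2 i) (q.1 i) i) ≠ 0 →
      (∑ i, d ((P 0).2 i)) ≤ (∑ i, d (q.2 i)) ∧ (∑ i, d (q.2 i)) ≤ ∑ i, d ((P (Fin.last r)).2 i))
    (hno : ∀ q : Equiv.Perm (Fin m) × (Fin m → Fin K), (∏ i, S (q.2 i) (q.1 i) i) ≠ 0 → ∀ k : Fin r,
      ¬ ((∑ i, d ((P k.castSucc).2 i)) < (∑ i, d (q.2 i)) ∧ (∑ i, d (q.2 i)) < ∑ i, d ((P k.succ).2 i))) :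
    ((Matrix.det (∑ l, ((X : ℝ[X]) ^ d l) • (S l).map C)).roots.toFinset.filter (fun t => 0 < t)).card
      = (Finset.univ.filter (fun k : Fin r =>
          ((((Equiv.Perm.sign (P k.castSucc).1 : ℤ) : ℝ) * ∏ i, S ((P k.castSucc).2 i) ((P k.castSucc).1 i) i)
            * (((Equiv.Perm.sign (P k.succ).1 : ℤ) : ℝ) * ∏ i, S ((P k.succ).2 i) ((P k.succ).1 i) i)) < 0)).card := by
  classical
  set g := Matrix.det (∑ l, ((X : ℝ[X]) ^ d l) • (S l).map C) with hg
  have hapos : ∀ k, 0 < a k := fun k => lt_of_lt_of_le ha0 (ha.monotone (Fin.zero_le _))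
  have hdom : ∀ k, ∑ s ∈ g.support.erase (∑ i, d ((P k).2 i)), |g.coeff s| * a k ^ s
      < |g.coeff (∑ i, d ((P k).2 i))| * a k ^ (∑ i, d ((P k).2 i)) :=
    fun k => monomial_dominant_of_leibniz_dominant d S (hapos k) (P k) (hdomL k)
  have hsign : ∀ k, 0 < (((Equiv.Perm.sign (P k).1 : ℤ) : ℝ) * ∏ i, S ((P k).2 i) ((P k).1 i) i)
      * g.coeff (∑ i, d ((P k).2 i)) :=
    fun k => term_mul_coeff_pos_of_leibniz_dominant d S (hapos k) (P k) (hdomL k)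
  rw [card_posRoots_eq_card_alternating_of_chain g r (fun k => ∑ i, d ((P k).2 i)) a ha ha0 hdom
    (fun s hs => ?_) (fun s hs => ?_) (fun s hs k => ?_)]
  · refine Finset.card_bij (fun k _ => k) (fun k hk => ?_) (fun _ _ _ _ h => h) (fun k hk => ⟨k, ?_, rfl⟩)
    · rw [Finset.mem_filter] at hk ⊢
      refine ⟨hk.1, ?_⟩
      have key := mul_pos (hsign k.castSucc) (hsign k.succ)
      by_contra hge; push Not at hge
      nlinarith [mul_nonpos_of_nonneg_of_nonpos hge hk.2.le]
    · rw [Finset.mem_filter] at hk ⊢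
      refine ⟨hk.1, ?_⟩
      have key := mul_pos (hsign k.castSucc) (hsign k.succ)
      by_contra hge; push Not at hge
      nlinarith [mul_nonpos_of_nonpos_of_nonneg hk.2.le hge]
  · obtain ⟨q, hq, hqs⟩ := exists_term_of_mem_support d S hs
    rw [← hqs]; exact (hrange q hq).1
  · obtain ⟨q, hq, hqs⟩ := exists_term_of_mem_support d S hs
    rw [← hqs]; exact (hrange q hq).2
  · obtain ⟨q, hq, hqs⟩ := exists_term_of_mem_support d S hs
    rw [← hqs]; exact hno q hq k

end Summit.ValiantsHypothesis.ValiantsHypothesis.Theorems.KPlusLogSqLaw.LocalDescartes
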